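import Summits.QuantumFields.BalabanUV.Beta.CovariantTowerDecayTorus
import Literature.MathematicalPhysics.QuantumFieldTheory.Balaban1983to89.B9Thm37GlueTorusCovDT

/-!
# Beta / CovariantTowerDecaySup — the (3.42) ENTRIES 1–3 SHAPE for the k-fold covariant TOWER operator of the pv21
# MODEL on the torus: SUP-NORM LOCALISED-SOURCE decay of (Δ_U + Σ_{l≤k} a_l·G_lᵀG_l)⁻¹, entrywise and sup-localised decay
# of ∇_U(…)⁻¹ and of (…)⁻¹∇_U\*, UNIFORM IN THE VOLUME N AND IN THE TRANSPORT U, explicit constants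
# (unit `b2b-balaban-beta-d4-p2`, GEN 4; fourth module of the chain `CovariantTowerDecay` → `…CT` → `…Torus` → this;
# node (m2) of `beta/skeletons/D4-NODE-O2-b2b-balaban-beta-d4-p2.md`)

HONEST FRAMING: discharging `BetaPertH` makes Bałaban's UV stability UNCONDITIONAL — NOT the continuum limit, NOT the
Clay problem.  HONEST DEPENDENCY (verbatim): «continuum YM on T⁴ ⇐ BetaPertH ∧ nine spine estimates (0/9 proved);
BetaPertH ⇐ (D1) ∧ (D4) ∧ CAP+tail; G-an2-4 gates asym, D1 and NE2/3/4.»  THIS MODULE DISCHARGES NOTHING of `BetaPertH`,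
asserts NOTHING printed and cites nothing as a fact (ABSOLUTE RULE): [folklore] kernel theorems about the component MODEL
of the pv21 chain `Literature/…/Balaban1983to89/B9Thm37GlueTorusCov*` ([B9] = `Balaban1985BackgroundPropagators`,
T. Bałaban, *Propagators for lattice gauge theories in a background field*, Commun. Math. Phys. 99 (1985) 389–434:
(3.15)/(3.16)/(3.19)/(3.23)–(3.24); SHAPE modelled: the first three inequalities of (3.42), Thm 3.1 p. 397, «for an
arbitrary configuration U»).  It is the tower analogue, theorem by theorem, of pv21's ONE-STEP modules
`B9Thm37GlueTorusCovSup` / `B9Thm37GlueTorusCovDT`, whose operator-agnostic lemmas (`abs_apply_le_sum`,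
`sum_localized_le`, `abs_sum_Rm_mul_le`, `apply_transpose_eq_sum`, `sum_bond_localized_le`) are applied BY NAME to the
entrywise tower decay `CovariantTowerDecayTorus.entry_decay_tower_torus_explicit`.

CONTENT (Δ′ := Δ_U + Σ_{l≤k} a_l·G_lᵀG_l with block weights, full cover; G′ := Δ′⁻¹; σ_k = `sigmaTowerTorus`, θ_T =
`thetaTowerTorus d M σ_k c_max w_max k a`; every torus `UT N`, cube-comb tower of sides M_j ∣ N_i, every isometric transport).
* §1 `isTransposePair_inverse_towerOp` (G′ symmetric), `inverse_towerOp_covDT_apply` ((G′∇_U\*λ)(p) = Σ_q λ(q)(∇_UG′δ_p)(q)).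
* §2 `supConstTower`, `sup_decay_tower_torus` (|(G′f)(p)| ≤ B·e^{−(θ_T/2)R}·m for |f| ≤ m supported in X × Cp at
  distance ≥ R from p₁), `sup_bound_tower_torus` (ℓ^∞ → ℓ^∞ bound B).
* §3 `covD_entry_decay_tower_torus` (|(∇_UG′δ_{p₀})(b,k)| ≤ c_max(|Cp|+1)e^{θ_T}(2/σ_k)e^{−θ_T dist(p₀,₁, b₋)}),
  `covDT_entry_decay_tower_torus` (transposed), `covDT_sup_decay_tower_torus`, `covDT_sup_bound_tower_torus`.

NOT ASSERTED: anything printed; ℓ^∞/entrywise norms on the bond-step distance of `UT N`, crude and k-DEPENDENT constants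
(σ_k of `coercive_towerOp`: item (v) of the O.2 skeleton), no Hölder entries, no fourth entry Δ_UG′, no vector-field
operators, no random-walk expansion.  Row D4: RECORDS value (NODE A.4.0 entries 1–3, scalar side, at term level IN THE
MODEL); class of (T3)/NODE O.2 unchanged; D4 DISCHARGE NO DATE; NOT BetaPertH, NOT continuum, NOT Clay.
-/

namespace Summit.QuantumFields.BalabanUV.Beta.CovariantTowerDecaySup

open Finset
open Literature.MathematicalPhysics.QuantumFieldTheory.Balaban1983to89
open B9Thm37Sum B9Thm37Glue B9Thm37GluePU B9Thm37GlueTorusInv B9Thm37GlueTorusCov B9Thm37GlueTorusCovComp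
open B9Thm37GlueTorusCovPoinc (tdepth_le card_block_le)
open B9Thm37GlueTorusCovLevels B9Thm37GlueTorusCovLevelsPoinc B9Thm37GlueTorusCovTower B9Thm37GlueTorusCovTowerDir
open B9Thm37GlueTorusCovSup (abs_apply_le_sum sum_localized_le abs_sum_Rm_mul_le)
open B9Thm37GlueTorusCovDT (apply_transpose_eq_sum sum_bond_localized_le)
open Summit.QuantumFields.BalabanUV.Beta.CovariantTowerDecay
open Summit.QuantumFields.BalabanUV.Beta.CovariantTowerDecayCT
open Summit.QuantumFields.BalabanUV.Beta.CovariantTowerDecayTorus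
open B5TorusCover (UT Ctr)
open B5Leibniz121 (up dist_up_le)

noncomputable section

/-! ## §1  Transposition: the tower inverse is symmetric; the kernel of G′∇_U\* is the transpose of that of ∇_UG′ -/

section Generic

variable {St Bd Cp : Type} [Fintype St] [DecidableEq St] [Fintype Bd] [Fintype Cp] [DecidableEq Cp]
  {src tgt : Bd → St} {Bs : ℕ → Type} [∀ j, Fintype (Bs j)] [∀ j, DecidableEq (Bs j)]
  (Ks : ∀ j, Comb src tgt (Bs j)) (Rm : Bd → Cp → Cp → ℝ)

/-- **G′ = (Δ_U + Σ_{l≤k} a_lG_lᵀG_l)⁻¹ is SYMMETRIC** for the component pairing (full cover): the two-sided inverse of a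
symmetric unit (`isTransposePair_levelOp`, `mul_inverse_towerOp`, `B9Thm37GlueSz.isTransposePair_inv`). [folklore] -/
theorem isTransposePair_inverse_towerOp
    (hRm : ∀ b i j, ∑ k, Rm b k i * Rm b k j = if i = j then (1 : ℝ) else 0)
    {c : Bd → ℝ} {cmin : ℝ} (hcmin : 0 < cmin) (hc : ∀ b, cmin ≤ |c b|) {D n : ℕ → ℕ}
    (hD : ∀ j x, (Ks j).depth x ≤ D j) (hn : ∀ j β, (univ.filter fun x => (Ks j).blk x = β).card ≤ n j)
    (k : ℕ) (w : Fin (k + 1) → St → ℝ) {a : Fin (k + 1) → ℝ} (ha : ∀ l, 0 ≤ a l) {amin wmin : ℝ}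
    (hamin : 0 < amin) (hwmin : 0 < wmin)
    (hcov : ∀ x, ∃ l : Fin (k + 1), amin ≤ a l ∧ wmin ≤ |w l (towerBlk Ks (l : ℕ) x)|) :
    IsTransposePair (Ring.inverse (towerOp Ks Rm c k (fun l x => w l (towerBlk Ks (l : ℕ) x)) a))
      (Ring.inverse (towerOp Ks Rm c k (fun l x => w l (towerBlk Ks (l : ℕ) x)) a)) :=
  B9Thm37GlueSz.isTransposePair_inv
    (isTransposePair_levelOp src tgt c Rm (fun l : Fin (k + 1) => towerBlk Ks (l : ℕ))
      (fun l x => w l (towerBlk Ks (l : ℕ) x)) (fun l => towerTr Ks Rm (l : ℕ)) a)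
    (mul_inverse_towerOp Ks Rm hRm hcmin hc hD hn k w ha hamin hwmin hcov)
    (mul_inverse_towerOp Ks Rm hRm hcmin hc hD hn k w ha hamin hwmin hcov)

/-- **THE ADJOINT REPRESENTATION OF G′∇_U\* (MODEL)**: (G′∇_U\*λ)(p) = Σ_q λ(q)·(∇_UG′δ_p)(q) for every bond field λ.
[folklore] -/
theorem inverse_towerOp_covDT_apply
    (hRm : ∀ b i j, ∑ k, Rm b k i * Rm b k j = if i = j then (1 : ℝ) else 0)
    {c : Bd → ℝ} {cmin : ℝ} (hcmin : 0 < cmin) (hc : ∀ b, cmin ≤ |c b|) {D n : ℕ → ℕ}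
    (hD : ∀ j x, (Ks j).depth x ≤ D j) (hn : ∀ j β, (univ.filter fun x => (Ks j).blk x = β).card ≤ n j)
    (k : ℕ) (w : Fin (k + 1) → St → ℝ) {a : Fin (k + 1) → ℝ} (ha : ∀ l, 0 ≤ a l) {amin wmin : ℝ}
    (hamin : 0 < amin) (hwmin : 0 < wmin)
    (hcov : ∀ x, ∃ l : Fin (k + 1), amin ≤ a l ∧ wmin ≤ |w l (towerBlk Ks (l : ℕ) x)|)
    (lam : Bd × Cp → ℝ) (p : St × Cp) :
    Ring.inverse (towerOp Ks Rm c k (fun l x => w l (towerBlk Ks (l : ℕ) x)) a) (covDT src tgt c Rm lam) p =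
      ∑ q, lam q * covD src tgt c Rm
        (Ring.inverse (towerOp Ks Rm c k (fun l x => w l (towerBlk Ks (l : ℕ) x)) a) (Pi.single p 1)) q :=
  apply_transpose_eq_sum (isTransposePair_inverse_towerOp Ks Rm hRm hcmin hc hD hn k w ha hamin hwmin hcov)
    (isTransposePair_covD src tgt c Rm) lam p

end Generic

/-! ## §2  The torus: sup-norm, localised-source decay of the tower inverse, uniform in N and U -/

section Torus

variable {d : ℕ} {N : Fin d → ℕ} [∀ i, NeZero (N i)] [NeZero d]

/-- MODEL bookkeeping: **the sup constant of the tower**, B = (2/σ_k)·n_C·K_d(θ_T/2), σ_k = `sigmaTowerTorus`,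
θ_T = `thetaTowerTorus d M σ_k c_max w_max k a`, K_d = `B4Sect5Proof.latticeConst`, n_C the number of colour components.
[folklore] -/
def supConstTower (d : ℕ) (M : ℕ → ℕ) (amin wmin cmin cmax wmax : ℝ) (k : ℕ) (a : Fin (k + 1) → ℝ) (nC : ℕ) : ℝ :=
  2 / sigmaTowerTorus d M amin wmin cmin k *
    (nC * B4Sect5Proof.latticeConst d
      (thetaTowerTorus d M (sigmaTowerTorus d M amin wmin cmin k) cmax wmax k a / 2))

/-- B ≥ 0. [folklore] -/
theorem supConstTower_nonneg (d : ℕ) (M : ℕ → ℕ) {amin wmin : ℝ} (hamin : 0 < amin) (hwmin : 0 < wmin)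
    (cmin cmax wmax : ℝ) (k : ℕ) {a : Fin (k + 1) → ℝ} (ha : ∀ l, 0 ≤ a l) (nC : ℕ) :
    0 ≤ supConstTower d M amin wmin cmin cmax wmax k a nC := by
  unfold supConstTower
  have hσ := sigmaTowerTorus_pos d M cmin k hamin hwmin
  have hθ := thetaTower_pos hσ cmax wmax d (fun j => d * (M j - 1)) (fun j => M j ^ d) k ha
  refine mul_nonneg (div_nonneg (by norm_num) hσ.le) (mul_nonneg (Nat.cast_nonneg _) ?_)
  exact B4Sect5Proof.latticeConst_nonneg d (half_pos hθ).le

/-- **SUP-NORM, LOCALISED-SOURCE DECAY OF THE k-FOLD TOWER INVERSE ON EVERY TORUS, UNIFORM IN THE VOLUME AND IN THE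
TRANSPORT (MODEL of (3.42), entry 1, sup form).**  Torus `UT N`, cube-comb tower of sides M_j (1 ≤ M_j, M_j ∣ N_i),
every isometric transport, c_min ≤ |c| ≤ c_max, block weights w_min ≤ |w_l| ≤ w_max, a_l ≥ 0 with the (k+1)-level cover,
every site set X, every field f vanishing off X × Cp with |f| ≤ m, every point p and every R with R ≤ dist(x′, p₁) for
x′ ∈ X:  |(G′f)(p)| ≤ B·e^{−(θ_T/2)R}·m, B = `supConstTower …`. [folklore] -/
theorem sup_decay_tower_torus {Cp : Type} [Fintype Cp] [DecidableEq Cp] {M : ℕ → ℕ} (hM : ∀ j, 1 ≤ M j)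
    (hdiv : ∀ j i, M j ∣ N i) (c : UT N × Fin d → ℝ) {cmin cmax : ℝ} (hcmin : 0 < cmin) (hc : ∀ b, cmin ≤ |c b|)
    (hc' : ∀ b, |c b| ≤ cmax) (Rm : UT N × Fin d → Cp → Cp → ℝ)
    (hRm : ∀ b i j, ∑ k, Rm b k i * Rm b k j = if i = j then (1 : ℝ) else 0) (k : ℕ)
    (w : Fin (k + 1) → UT N → ℝ) {wmax : ℝ} (hw' : ∀ l y, |w l y| ≤ wmax) {a : Fin (k + 1) → ℝ} (ha : ∀ l, 0 ≤ a l)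
    {amin wmin : ℝ} (hamin : 0 < amin) (hwmin : 0 < wmin)
    (hcov : ∀ x, ∃ l : Fin (k + 1), amin ≤ a l ∧ wmin ≤ |w l (towerBlk (torusTower hM hdiv) (l : ℕ) x)|)
    (X : Finset (UT N)) (f : UT N × Cp → ℝ) (hfX : ∀ p', p'.1 ∉ X → f p' = 0) {m : ℝ}
    (hfm : ∀ p', |f p'| ≤ m) (p : UT N × Cp) {R : ℝ} (hR : ∀ x' ∈ X, R ≤ dist x' p.1) :
    |Ring.inverse (towerOp (torusTower hM hdiv) Rm c k
        (fun l x => w l (towerBlk (torusTower hM hdiv) (l : ℕ) x)) a) f p| ≤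
      supConstTower d M amin wmin cmin cmax wmax k a (Fintype.card Cp) *
        Real.exp (-(thetaTowerTorus d M (sigmaTowerTorus d M amin wmin cmin k) cmax wmax k a / 2 * R)) * m := by
  set σ := sigmaTowerTorus d M amin wmin cmin k with hσdef
  set θ := thetaTowerTorus d M σ cmax wmax k a with hθdef
  have hσ0 : 0 < σ := sigmaTowerTorus_pos d M cmin k hamin hwmin
  have hθ0 : 0 < θ := thetaTower_pos hσ0 cmax wmax d (fun j => d * (M j - 1)) (fun j => M j ^ d) k ha
  have hA : 0 ≤ 2 / σ := div_nonneg (by norm_num) hσ0.le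
  have hm : 0 ≤ m := (abs_nonneg _).trans (hfm p)
  set G := Ring.inverse (towerOp (torusTower hM hdiv) Rm c k
    (fun l x => w l (towerBlk (torusTower hM hdiv) (l : ℕ) x)) a) with hGdef
  have h1 := abs_apply_le_sum G f p (Bk := fun p' => 2 / σ * Real.exp (-(θ * dist p'.1 p.1)))
    (fun p' => entry_decay_tower_torus_explicit hM hdiv c hcmin hc hc' Rm hRm k w hw' ha hamin hwmin hcov p' p)
  have h2 := sum_localized_le (Cp := Cp) hA hθ0.le X p.1 hR f hfX hfm hm
  have h3 : ∑ x' : UT N, Real.exp (-(θ / 2 * dist p.1 x')) ≤ B4Sect5Proof.latticeConst d (θ / 2) :=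
    B4Sect5Torus.torusSum_le d (UT.one_le N) (half_pos hθ0) (UT.toSite N p.1)
  have hpre : 0 ≤ 2 / σ * m * Real.exp (-(θ / 2 * R)) := mul_nonneg (mul_nonneg hA hm) (Real.exp_pos _).le
  calc |G f p| ≤ _ := h1
    _ ≤ _ := h2
    _ ≤ 2 / σ * m * Real.exp (-(θ / 2 * R)) * (Fintype.card Cp * B4Sect5Proof.latticeConst d (θ / 2)) :=
        mul_le_mul_of_nonneg_left (mul_le_mul_of_nonneg_left h3 (Nat.cast_nonneg _)) hpre
    _ = _ := by unfold supConstTower; ring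

/-- **THE ℓ^∞ → ℓ^∞ OPERATOR NORM OF THE k-FOLD TOWER INVERSE IS BOUNDED UNIFORMLY IN THE VOLUME AND IN THE TRANSPORT
(MODEL).**  |(G′f)(p)| ≤ B·m whenever |f| ≤ m. [folklore] -/
theorem sup_bound_tower_torus {Cp : Type} [Fintype Cp] [DecidableEq Cp] {M : ℕ → ℕ} (hM : ∀ j, 1 ≤ M j)
    (hdiv : ∀ j i, M j ∣ N i) (c : UT N × Fin d → ℝ) {cmin cmax : ℝ} (hcmin : 0 < cmin) (hc : ∀ b, cmin ≤ |c b|)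
    (hc' : ∀ b, |c b| ≤ cmax) (Rm : UT N × Fin d → Cp → Cp → ℝ)
    (hRm : ∀ b i j, ∑ k, Rm b k i * Rm b k j = if i = j then (1 : ℝ) else 0) (k : ℕ)
    (w : Fin (k + 1) → UT N → ℝ) {wmax : ℝ} (hw' : ∀ l y, |w l y| ≤ wmax) {a : Fin (k + 1) → ℝ} (ha : ∀ l, 0 ≤ a l)
    {amin wmin : ℝ} (hamin : 0 < amin) (hwmin : 0 < wmin)
    (hcov : ∀ x, ∃ l : Fin (k + 1), amin ≤ a l ∧ wmin ≤ |w l (towerBlk (torusTower hM hdiv) (l : ℕ) x)|)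
    (f : UT N × Cp → ℝ) {m : ℝ} (hfm : ∀ p', |f p'| ≤ m) (p : UT N × Cp) :
    |Ring.inverse (towerOp (torusTower hM hdiv) Rm c k
        (fun l x => w l (towerBlk (torusTower hM hdiv) (l : ℕ) x)) a) f p| ≤
      supConstTower d M amin wmin cmin cmax wmax k a (Fintype.card Cp) * m := by
  have h := sup_decay_tower_torus hM hdiv c hcmin hc hc' Rm hRm k w hw' ha hamin hwmin hcov Finset.univ f
    (fun p' hp' => absurd (mem_univ p'.1) hp') hfm p (R := 0) (fun x' _ => dist_nonneg)
  simpa using h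

/-! ## §3  The torus: entrywise and sup-norm localised decay of ∇_UG′ and of G′∇_U\*, uniform in N and U -/

/-- **ENTRYWISE DECAY OF ∇_UG′δ_{p₀} AT THE FULL RATE θ_T (MODEL of (3.42), entry 2, point source).**  For every point
p₀, bond b and colour k′: |(∇_UG′δ_{p₀})(b, k′)| ≤ c_max·(|Cp| + 1)·e^{θ_T}·(2/σ_k)·e^{−θ_T·dist(p₀,₁, b₋)} (the far
endpoint b₊ is at distance ≤ 1 from b₋ and costs e^{θ_T}; |R(b)_{k′j}| ≤ 1 costs |Cp|). [folklore] -/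
theorem covD_entry_decay_tower_torus {Cp : Type} [Fintype Cp] [DecidableEq Cp] {M : ℕ → ℕ} (hM : ∀ j, 1 ≤ M j)
    (hdiv : ∀ j i, M j ∣ N i) (c : UT N × Fin d → ℝ) {cmin cmax : ℝ} (hcmin : 0 < cmin) (hc : ∀ b, cmin ≤ |c b|)
    (hc' : ∀ b, |c b| ≤ cmax) (Rm : UT N × Fin d → Cp → Cp → ℝ)
    (hRm : ∀ b i j, ∑ k, Rm b k i * Rm b k j = if i = j then (1 : ℝ) else 0) (k : ℕ)
    (w : Fin (k + 1) → UT N → ℝ) {wmax : ℝ} (hw' : ∀ l y, |w l y| ≤ wmax) {a : Fin (k + 1) → ℝ} (ha : ∀ l, 0 ≤ a l)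
    {amin wmin : ℝ} (hamin : 0 < amin) (hwmin : 0 < wmin)
    (hcov : ∀ x, ∃ l : Fin (k + 1), amin ≤ a l ∧ wmin ≤ |w l (towerBlk (torusTower hM hdiv) (l : ℕ) x)|)
    (p₀ : UT N × Cp) (b : UT N × Fin d) (k' : Cp) :
    |covD bsrc btgt c Rm (Ring.inverse (towerOp (torusTower hM hdiv) Rm c k
        (fun l x => w l (towerBlk (torusTower hM hdiv) (l : ℕ) x)) a) (Pi.single p₀ 1)) (b, k')| ≤
      cmax * (Fintype.card Cp + 1) *
        Real.exp (thetaTowerTorus d M (sigmaTowerTorus d M amin wmin cmin k) cmax wmax k a) *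
        (2 / sigmaTowerTorus d M amin wmin cmin k *
          Real.exp (-(thetaTowerTorus d M (sigmaTowerTorus d M amin wmin cmin k) cmax wmax k a *
            dist p₀.1 (bsrc b)))) := by
  set σ := sigmaTowerTorus d M amin wmin cmin k with hσdef
  set θ := thetaTowerTorus d M σ cmax wmax k a with hθdef
  set A := 2 / σ with hAdef
  set G := Ring.inverse (towerOp (torusTower hM hdiv) Rm c k
    (fun l x => w l (towerBlk (torusTower hM hdiv) (l : ℕ) x)) a) with hGdef
  have hσ0 : 0 < σ := sigmaTowerTorus_pos d M cmin k hamin hwmin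
  have hθ0 : 0 < θ := thetaTower_pos hσ0 cmax wmax d (fun j => d * (M j - 1)) (fun j => M j ^ d) k ha
  have hA0 : 0 ≤ A := div_nonneg (by norm_num) hσ0.le
  have hent : ∀ q : UT N × Cp, |G (Pi.single p₀ 1) q| ≤ A * Real.exp (-(θ * dist p₀.1 q.1)) := fun q =>
    entry_decay_tower_torus_explicit hM hdiv c hcmin hc hc' Rm hRm k w hw' ha hamin hwmin hcov p₀ q
  have hfar : dist p₀.1 (bsrc b) ≤ dist p₀.1 (btgt b) + 1 := by
    have h1 : dist p₀.1 (bsrc b) ≤ dist p₀.1 (btgt b) + dist (btgt b) (bsrc b) := dist_triangle _ _ _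
    have h2 : dist (btgt b) (bsrc b) ≤ 1 := by
      obtain ⟨y, μ⟩ := b
      rw [btgt_apply, bsrc_apply, dist_comm]
      exact dist_up_le y μ
    linarith
  set W := Real.exp θ * (A * Real.exp (-(θ * dist p₀.1 (bsrc b)))) with hWdef
  have htgt : ∀ j, |G (Pi.single p₀ 1) (btgt b, j)| ≤ W := by
    intro j
    refine (hent (btgt b, j)).trans ?_
    rw [hWdef, ← mul_assoc, mul_comm (Real.exp θ) A, mul_assoc, ← Real.exp_add]
    refine mul_le_mul_of_nonneg_left (Real.exp_le_exp.mpr ?_) hA0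
    have := mul_le_mul_of_nonneg_left hfar hθ0.le
    simp only at this ⊢
    linarith
  have hsrc : |G (Pi.single p₀ 1) (bsrc b, k')| ≤ W := by
    refine (hent (bsrc b, k')).trans ?_
    rw [hWdef]
    exact le_mul_of_one_le_left (mul_nonneg hA0 (Real.exp_pos _).le) (Real.one_le_exp hθ0.le)
  have hcmax : 0 ≤ cmax := (abs_nonneg _).trans (hc' b)
  rw [covD_apply]
  calc |c (b, k').1 * (∑ j, Rm (b, k').1 (b, k').2 j * G (Pi.single p₀ 1) (btgt (b, k').1, j) -
          G (Pi.single p₀ 1) (bsrc (b, k').1, (b, k').2))|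
      ≤ cmax * (Fintype.card Cp * W + W) := by
        rw [abs_mul]
        refine mul_le_mul (hc' b) ?_ (abs_nonneg _) hcmax
        refine (abs_sub _ _).trans (add_le_add ?_ hsrc)
        refine (abs_sum_Rm_mul_le Rm hRm b k' _).trans ?_
        calc ∑ j, |G (Pi.single p₀ 1) (btgt b, j)| ≤ ∑ _j : Cp, W := Finset.sum_le_sum fun j _ => htgt j
          _ = Fintype.card Cp * W := by simp [Finset.sum_const, Finset.card_univ, nsmul_eq_mul]
    _ = cmax * (Fintype.card Cp + 1) * Real.exp θ * (A * Real.exp (-(θ * dist p₀.1 (bsrc b)))) := by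
        rw [hWdef]; ring

/-- **ENTRYWISE DECAY OF G′∇_U\*δ_{(b,k′)} (MODEL of (3.42), entry 3, point source)** — by transposition
(`inverse_towerOp_covDT_apply`) the bound of `covD_entry_decay_tower_torus` with source and evaluation exchanged. [folklore] -/
theorem covDT_entry_decay_tower_torus {Cp : Type} [Fintype Cp] [DecidableEq Cp] {M : ℕ → ℕ} (hM : ∀ j, 1 ≤ M j)
    (hdiv : ∀ j i, M j ∣ N i) (c : UT N × Fin d → ℝ) {cmin cmax : ℝ} (hcmin : 0 < cmin) (hc : ∀ b, cmin ≤ |c b|)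
    (hc' : ∀ b, |c b| ≤ cmax) (Rm : UT N × Fin d → Cp → Cp → ℝ)
    (hRm : ∀ b i j, ∑ k, Rm b k i * Rm b k j = if i = j then (1 : ℝ) else 0) (k : ℕ)
    (w : Fin (k + 1) → UT N → ℝ) {wmax : ℝ} (hw' : ∀ l y, |w l y| ≤ wmax) {a : Fin (k + 1) → ℝ} (ha : ∀ l, 0 ≤ a l)
    {amin wmin : ℝ} (hamin : 0 < amin) (hwmin : 0 < wmin)
    (hcov : ∀ x, ∃ l : Fin (k + 1), amin ≤ a l ∧ wmin ≤ |w l (towerBlk (torusTower hM hdiv) (l : ℕ) x)|)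
    (b : UT N × Fin d) (k' : Cp) (p : UT N × Cp) :
    |Ring.inverse (towerOp (torusTower hM hdiv) Rm c k
        (fun l x => w l (towerBlk (torusTower hM hdiv) (l : ℕ) x)) a) (covDT bsrc btgt c Rm (Pi.single (b, k') 1)) p| ≤
      cmax * (Fintype.card Cp + 1) *
        Real.exp (thetaTowerTorus d M (sigmaTowerTorus d M amin wmin cmin k) cmax wmax k a) *
        (2 / sigmaTowerTorus d M amin wmin cmin k *
          Real.exp (-(thetaTowerTorus d M (sigmaTowerTorus d M amin wmin cmin k) cmax wmax k a *
            dist p.1 (bsrc b)))) := by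
  rw [inverse_towerOp_covDT_apply (torusTower hM hdiv) Rm hRm hcmin hc (fun j x => tdepth_le (hM j) x)
    (fun j z => card_block_le (hM j) (hdiv j) z) k w ha hamin hwmin hcov, Fintype.sum_eq_single (b, k')
    (fun q hq => by rw [Pi.single_eq_of_ne hq, zero_mul]), Pi.single_eq_same, one_mul]
  exact covD_entry_decay_tower_torus hM hdiv c hcmin hc hc' Rm hRm k w hw' ha hamin hwmin hcov p b k'

/-- **SUP-NORM, LOCALISED-SOURCE DECAY OF G′∇_U\* ON EVERY TORUS, UNIFORM IN THE VOLUME AND IN THE TRANSPORT (MODEL of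
(3.42), entry 3).**  For every site set Y, every BOND field λ vanishing on the bonds (y, μ) with y ∉ Y and with |λ| ≤ m,
every point p and every R with R ≤ dist(y, p₁) for all y ∈ Y:
|(G′∇_U\*λ)(p)| ≤ c_max·(|Cp| + 1)·e^{θ_T}·d·B·e^{−(θ_T/2)·R}·m, B = `supConstTower …`. [folklore] -/
theorem covDT_sup_decay_tower_torus {Cp : Type} [Fintype Cp] [DecidableEq Cp] {M : ℕ → ℕ} (hM : ∀ j, 1 ≤ M j)
    (hdiv : ∀ j i, M j ∣ N i) (c : UT N × Fin d → ℝ) {cmin cmax : ℝ} (hcmin : 0 < cmin) (hc : ∀ b, cmin ≤ |c b|)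
    (hc' : ∀ b, |c b| ≤ cmax) (Rm : UT N × Fin d → Cp → Cp → ℝ)
    (hRm : ∀ b i j, ∑ k, Rm b k i * Rm b k j = if i = j then (1 : ℝ) else 0) (k : ℕ)
    (w : Fin (k + 1) → UT N → ℝ) {wmax : ℝ} (hw' : ∀ l y, |w l y| ≤ wmax) {a : Fin (k + 1) → ℝ} (ha : ∀ l, 0 ≤ a l)
    {amin wmin : ℝ} (hamin : 0 < amin) (hwmin : 0 < wmin)
    (hcov : ∀ x, ∃ l : Fin (k + 1), amin ≤ a l ∧ wmin ≤ |w l (towerBlk (torusTower hM hdiv) (l : ℕ) x)|)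
    (Y : Finset (UT N)) (lam : (UT N × Fin d) × Cp → ℝ) (hlamY : ∀ q, bsrc q.1 ∉ Y → lam q = 0) {m : ℝ}
    (hlamm : ∀ q, |lam q| ≤ m) (p : UT N × Cp) {R : ℝ} (hR : ∀ y ∈ Y, R ≤ dist y p.1) :
    |Ring.inverse (towerOp (torusTower hM hdiv) Rm c k
        (fun l x => w l (towerBlk (torusTower hM hdiv) (l : ℕ) x)) a) (covDT bsrc btgt c Rm lam) p| ≤
      cmax * (Fintype.card Cp + 1) *
        Real.exp (thetaTowerTorus d M (sigmaTowerTorus d M amin wmin cmin k) cmax wmax k a) * d *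
        (supConstTower d M amin wmin cmin cmax wmax k a (Fintype.card Cp) *
          Real.exp (-(thetaTowerTorus d M (sigmaTowerTorus d M amin wmin cmin k) cmax wmax k a / 2 * R)) * m) := by
  classical
  set σ := sigmaTowerTorus d M amin wmin cmin k with hσdef
  set θ := thetaTowerTorus d M σ cmax wmax k a with hθdef
  set A := 2 / σ with hAdef
  set G := Ring.inverse (towerOp (torusTower hM hdiv) Rm c k
    (fun l x => w l (towerBlk (torusTower hM hdiv) (l : ℕ) x)) a) with hGdef
  set C := cmax * (Fintype.card Cp + 1) * Real.exp θ with hCdef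
  have hσ0 : 0 < σ := sigmaTowerTorus_pos d M cmin k hamin hwmin
  have hθ0 : 0 < θ := thetaTower_pos hσ0 cmax wmax d (fun j => d * (M j - 1)) (fun j => M j ^ d) k ha
  have hA0 : 0 ≤ A := div_nonneg (by norm_num) hσ0.le
  have hm : 0 ≤ m := (abs_nonneg _).trans (hlamm ((p.1, (0 : Fin d)), p.2))
  have hcmax : 0 ≤ cmax := (abs_nonneg _).trans (hc' (p.1, (0 : Fin d)))
  have hC0 : 0 ≤ C := by rw [hCdef]; positivity
  have hq : ∀ q : (UT N × Fin d) × Cp, |lam q * covD bsrc btgt c Rm (G (Pi.single p 1)) q| ≤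
      C * (|lam q| * (A * Real.exp (-(θ * dist p.1 (bsrc q.1))))) := by
    intro q
    obtain ⟨b, k'⟩ := q
    rw [abs_mul]
    have h := covD_entry_decay_tower_torus hM hdiv c hcmin hc hc' Rm hRm k w hw' ha hamin hwmin hcov p b k'
    calc |lam (b, k')| * |covD bsrc btgt c Rm (G (Pi.single p 1)) (b, k')|
        ≤ |lam (b, k')| * (C * (A * Real.exp (-(θ * dist p.1 (bsrc b))))) :=
          mul_le_mul_of_nonneg_left h (abs_nonneg _)
      _ = _ := by ring
  have hsum := sum_bond_localized_le (Dir := Fin d) (Cp := Cp) hA0 hθ0.le Y p.1 hR lam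
    (fun q hq' => hlamY q hq') hlamm hm
  have h3 : ∑ x' : UT N, Real.exp (-(θ / 2 * dist p.1 x')) ≤ B4Sect5Proof.latticeConst d (θ / 2) :=
    B4Sect5Torus.torusSum_le d (UT.one_le N) (half_pos hθ0) (UT.toSite N p.1)
  have hpre : 0 ≤ A * m * Real.exp (-(θ / 2 * R)) := mul_nonneg (mul_nonneg hA0 hm) (Real.exp_pos _).le
  rw [inverse_towerOp_covDT_apply (torusTower hM hdiv) Rm hRm hcmin hc (fun j x => tdepth_le (hM j) x)
    (fun j z => card_block_le (hM j) (hdiv j) z) k w ha hamin hwmin hcov lam p]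
  calc |∑ q, lam q * covD bsrc btgt c Rm (G (Pi.single p 1)) q|
      ≤ ∑ q, |lam q * covD bsrc btgt c Rm (G (Pi.single p 1)) q| := Finset.abs_sum_le_sum_abs _ _
    _ ≤ ∑ q, C * (|lam q| * (A * Real.exp (-(θ * dist p.1 (bsrc q.1))))) := Finset.sum_le_sum fun q _ => hq q
    _ = C * ∑ q : (UT N × Fin d) × Cp, |lam q| * (A * Real.exp (-(θ * dist p.1 q.1.1))) := by
        rw [Finset.mul_sum]; rfl
    _ ≤ C * (A * m * Real.exp (-(θ / 2 * R)) *
          ((Fintype.card (Fin d) * Fintype.card Cp) * ∑ x', Real.exp (-(θ / 2 * dist p.1 x')))) :=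
        mul_le_mul_of_nonneg_left hsum hC0
    _ ≤ C * (A * m * Real.exp (-(θ / 2 * R)) *
          ((Fintype.card (Fin d) * Fintype.card Cp) * B4Sect5Proof.latticeConst d (θ / 2))) :=
        mul_le_mul_of_nonneg_left (mul_le_mul_of_nonneg_left
          (mul_le_mul_of_nonneg_left h3 (by positivity)) hpre) hC0
    _ = _ := by rw [hCdef, hAdef, Fintype.card_fin]; unfold supConstTower; ring

/-- **THE ℓ^∞ → ℓ^∞ OPERATOR NORM OF G′∇_U\* IS BOUNDED UNIFORMLY IN THE VOLUME AND IN THE TRANSPORT (MODEL).**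
|(G′∇_U\*λ)(p)| ≤ c_max·(|Cp| + 1)·e^{θ_T}·d·B·m whenever |λ| ≤ m. [folklore] -/
theorem covDT_sup_bound_tower_torus {Cp : Type} [Fintype Cp] [DecidableEq Cp] {M : ℕ → ℕ} (hM : ∀ j, 1 ≤ M j)
    (hdiv : ∀ j i, M j ∣ N i) (c : UT N × Fin d → ℝ) {cmin cmax : ℝ} (hcmin : 0 < cmin) (hc : ∀ b, cmin ≤ |c b|)
    (hc' : ∀ b, |c b| ≤ cmax) (Rm : UT N × Fin d → Cp → Cp → ℝ)
    (hRm : ∀ b i j, ∑ k, Rm b k i * Rm b k j = if i = j then (1 : ℝ) else 0) (k : ℕ)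
    (w : Fin (k + 1) → UT N → ℝ) {wmax : ℝ} (hw' : ∀ l y, |w l y| ≤ wmax) {a : Fin (k + 1) → ℝ} (ha : ∀ l, 0 ≤ a l)
    {amin wmin : ℝ} (hamin : 0 < amin) (hwmin : 0 < wmin)
    (hcov : ∀ x, ∃ l : Fin (k + 1), amin ≤ a l ∧ wmin ≤ |w l (towerBlk (torusTower hM hdiv) (l : ℕ) x)|)
    (lam : (UT N × Fin d) × Cp → ℝ) {m : ℝ} (hlamm : ∀ q, |lam q| ≤ m) (p : UT N × Cp) :
    |Ring.inverse (towerOp (torusTower hM hdiv) Rm c k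
        (fun l x => w l (towerBlk (torusTower hM hdiv) (l : ℕ) x)) a) (covDT bsrc btgt c Rm lam) p| ≤
      cmax * (Fintype.card Cp + 1) *
        Real.exp (thetaTowerTorus d M (sigmaTowerTorus d M amin wmin cmin k) cmax wmax k a) * d *
        (supConstTower d M amin wmin cmin cmax wmax k a (Fintype.card Cp) * m) := by
  have h := covDT_sup_decay_tower_torus hM hdiv c hcmin hc hc' Rm hRm k w hw' ha hamin hwmin hcov Finset.univ lam
    (fun q hq => absurd (mem_univ (bsrc q.1)) hq) hlamm p (R := 0) (fun y _ => dist_nonneg)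
  simpa using h

end Torus

end

end Summit.QuantumFields.BalabanUV.Beta.CovariantTowerDecaySup
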